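import Mathlib
import Literature.Barriers.CriticalPhenomena.PositionSpaceRGNonGibbsianChessboard
import HarnessLib

/-!
# The abstract chessboard estimate in letter form on an even torus of cells: generic dimension
(auxiliary file for stub `stub_chessboard` of crux stmt-QuantumFields-9735, line Sketch)

Fröhlich–Israel–Lieb–Simon, Comm. Math. Phys. **62** (1978), Thms. 4.1/4.3 (also Friedli–Velenik
2017, Thm. 10.11; Biskup, LNM 1970 (2009), Thm. 5.8), in LETTER form, for EVERY even period `N`
(no dyadic restriction; the cell reflections `cellReflect`, halves and runs `boxRun`, `axisRun` of
the sets-only template `Literature.Barriers.CriticalPhenomena.PositionSpaceRGNonGibbsianChessboard`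
are reused): cells are the points of the torus `(ℤ/N)^d` (`BlockIdx d N`), a word assigns a letter
of `β` to every cell, the letters carry maps `ρ i : β → β` (reflections of a cell observable in the
`d` axes), `Φ` is a real functional on words.  The symmetrisation operators are ANY `P M` agreeing
pointwise with `P i k v c = if (cᵢ - k).val < N/2 then v c else ρ i (v (θ_{i,k} c))` (the word
carried by `F · ΘF` for the reflection `θ_{i,k} = cellReflect i k` through the cell boundaries
`k`, `k + N/2` of axis `i`) and the mirror formula for `M`; no definitions are introduced.

* `reach`: the combinatorial core of the extremal ("doubling") argument: a property of words stable
  under all `P i k`, `M i k` passes from `v₀` to any PATTERN WORD `q` (`ρ i (q (θ_{i,k} c)) = q c`)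
  through one of its letters: runs of `1, 2, …, 2^J` cells (`2^J ≤ N < 2^(J+1)`) along an axis are
  doubled by `M` at the boundary ending the run, the last one is completed to the full axis by `P`
  at the boundary starting it; then the next axis.
* `phi_eq_zero_of_pat` (zero case: `Φ v ≠ 0` is stable, by Cauchy–Schwarz),
  `abs_pow_le_prod_of_pos` (positive case: maximise `|Φ v|^(N^d) / ∏_c Φ(pat (v c))`, both
  symmetrisations of a maximiser are maximisers, a pattern word is reached, where the ratio is `1`),
  and the registered `stub_chessboardAux`: `|Φ w|^(N^d) ≤ ∏_c Φ (pat (w c))` from translation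
  invariance, non-negativity of `Φ ∘ P i 0` and Cauchy–Schwarz at the boundary `0 | N/2` (moved to
  all boundaries by `symP_eq_shift`, `symM_eq_symP`).

References: J. Fröhlich, R. Israel, E. H. Lieb, B. Simon, Comm. Math. Phys. 62 (1978) 1–34,
Thms. 4.1, 4.3 [FrohlichIsraelLiebSimon1978]; S. Friedli, Y. Velenik, *Statistical Mechanics of
Lattice Systems*, CUP 2017, Theorem 10.11 [FriedliVelenik2017]; M. Biskup, LNM 1970 (2009),
Thm. 5.8 [Biskup2009].
-/

noncomputable section

open Finset
open Literature.Barriers.CriticalPhenomena.NonGibbs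

namespace Summit.QuantumFields.QCD.Theorems.UnquenchedChessboardBoundLine

namespace Chessboard

section Generic

variable {d N : ℕ} {β : Type*} {ρ : Fin d → β → β}
  {P M : Fin d → ZMod N → (BlockIdx d N → β) → BlockIdx d N → β}
  (hPd : ∀ i k v c,
    P i k v c = if (c i - k).val < N / 2 then v c else ρ i (v (cellReflect i k c)))
  (hMd : ∀ i k v c,
    M i k v c = if (c i - k).val < N / 2 then ρ i (v (cellReflect i k c)) else v c)

/-! ### Moving the reflection hypotheses from the boundary `0 | N/2` to all boundaries -/

/-- Conjugating the boundary-`0` reflection by the translation by `k eᵢ` gives the boundary-`k`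
reflection. [folklore] -/
theorem cellReflect_zero_add_single (i : Fin d) (k : ZMod N) (c : BlockIdx d N) :
    cellReflect i 0 (c + -Pi.single i k) + Pi.single i k = cellReflect i k c := by
  ext j
  by_cases hj : j = i
  · subst hj; simp; ring
  · simp [hj]

include hPd in
/-- The `P`-symmetrised word at boundary `k` is the translate by `-k eᵢ` of the `P`-symmetrised word
at boundary `0` of the translate by `k eᵢ`. [folklore] -/
theorem symP_eq_shift (i : Fin d) (k : ZMod N) (v : BlockIdx d N → β) :
    P i k v = fun c => P i 0 (fun c' => v (c' + Pi.single i k)) (c + -Pi.single i k) := by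
  funext c
  have h1 : (c + -(Pi.single i k : BlockIdx d N)) i - 0 = c i - k := by simp [sub_eq_add_neg]
  simp only [hPd, h1, neg_add_cancel_right, cellReflect_zero_add_single]

include hMd in
/-- The same for the `M`-symmetrised word (same formula). [folklore] -/
theorem symM_eq_shift (i : Fin d) (k : ZMod N) (v : BlockIdx d N → β) :
    M i k v = fun c => M i 0 (fun c' => v (c' + Pi.single i k)) (c + -Pi.single i k) := by
  funext c
  have h1 : (c + -(Pi.single i k : BlockIdx d N)) i - 0 = c i - k := by simp [sub_eq_add_neg]
  simp only [hMd, h1, neg_add_cancel_right, cellReflect_zero_add_single]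

include hPd hMd in
/-- For even `N`, the word symmetrised in the negative half at boundary `k` is the word symmetrised
in the positive half at boundary `k + N/2`. [folklore] -/
theorem symM_eq_symP [NeZero N] (hN : Even N) (i : Fin d) (k : ZMod N) (v : BlockIdx d N → β) :
    M i k v = P i (k + ((N / 2 : ℕ) : ZMod N)) v := by
  have hN0 : 0 < N := Nat.pos_of_ne_zero (NeZero.ne N)
  have h2 : ((2 * (N / 2) : ℕ) : ZMod N) = 0 := by
    rw [Nat.two_mul_div_two_of_even hN, ZMod.natCast_self]
  have hval : (((N / 2 : ℕ) : ZMod N)).val = N / 2 := by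
    rw [ZMod.val_natCast, Nat.mod_eq_of_lt (Nat.div_lt_self hN0 one_lt_two)]
  funext c
  have hrefl : cellReflect i (k + ((N / 2 : ℕ) : ZMod N)) c = cellReflect i k c := by
    simp only [cellReflect_apply]
    congr 1
    push_cast at h2
    linear_combination h2
  have hcond : (c i - (k + ((N / 2 : ℕ) : ZMod N))).val < N / 2 ↔ ¬(c i - k).val < N / 2 := by
    rw [show c i - (k + ((N / 2 : ℕ) : ZMod N)) = (c i - k) - ((N / 2 : ℕ) : ZMod N) by ring]
    have hu := ZMod.val_lt (c i - k)
    obtain ⟨m, hm⟩ := hN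
    by_cases h : (c i - k).val < N / 2
    · rw [zmod_val_sub_natCast h (Nat.div_le_self N 2)]
      omega
    · rw [ZMod.val_sub (by rw [hval]; omega), hval]
      omega
  rw [hMd, hPd, hrefl]
  by_cases h : (c i - k).val < N / 2
  · rw [if_pos h, if_neg (fun h' => hcond.1 h' h)]
  · rw [if_neg h, if_pos (hcond.2 h)]

/-! ### The doubling argument -/

include hPd hMd in
/-- **One axis of the doubling argument.** If a property `Good` of words is stable under all
symmetrisations and `q` is a pattern word (`ρ i (q (θ_{i,k} c)) = q c`), then from a good word
agreeing with `q` on the box of cells fixed to `t₀` from axis `i` on one reaches a good word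
agreeing with `q` on the box fixed from axis `i+1` on: runs of `2^j` cells, `2^(j+1) ≤ N`, are
doubled by the reflection through the boundary `t₀ᵢ + 2^j`, and the last run (`2^J > N/2`) is
completed by the reflection through `t₀ᵢ`. [cite: FrohlichIsraelLiebSimon1978, Thm. 4.1 (proof)] -/
theorem reach_axis [NeZero N] (hN : Even N) {Good : (BlockIdx d N → β) → Prop}
    (hP : ∀ i k v, Good v → Good (P i k v)) (hM : ∀ i k v, Good v → Good (M i k v))
    {q : BlockIdx d N → β} (hq : ∀ i k c, ρ i (q (cellReflect i k c)) = q c) (t₀ : BlockIdx d N)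
    (i : Fin d) (h : ∃ v, Good v ∧ ∀ c ∈ boxRun t₀ i.val, v c = q c) :
    ∃ v, Good v ∧ ∀ c ∈ boxRun t₀ (i.val + 1), v c = q c := by
  have hJ1 : N < 2 ^ Nat.log 2 N * 2 := by
    have := Nat.lt_pow_succ_log_self one_lt_two N
    rwa [Nat.succ_eq_add_one, pow_succ] at this
  have hJ2 : 2 ^ Nat.log 2 N ≤ N := Nat.pow_log_le_self 2 (NeZero.ne N)
  -- doublings along axis `i`
  have key : ∀ j, j ≤ Nat.log 2 N → ∃ v, Good v ∧ ∀ c ∈ axisRun t₀ i j, v c = q c := by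
    intro j
    induction j with
    | zero => exact fun _ => by rw [axisRun_zero]; exact h
    | succ j ih =>
      intro hj
      obtain ⟨v, hv, hrun⟩ := ih (Nat.le_of_succ_le hj)
      have h2 : 2 ^ (j + 1) ≤ N := (Nat.pow_le_pow_right two_pos hj).trans hJ2
      have hj' : 2 ^ j ≤ N / 2 := by rw [pow_succ] at h2; omega
      refine ⟨M i (t₀ i + ((2 ^ j : ℕ) : ZMod N)) v, hM _ _ v hv, fun c hc => ?_⟩
      rcases mem_axisRun_succ h2 hc with h' | h'
      · have hcm : N / 2 ≤ (c i - (t₀ i + ((2 ^ j : ℕ) : ZMod N))).val :=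
          mem_halfMinus.1 (axisRun_subset_halfMinus hj' t₀ i h')
        rw [hMd, if_neg (not_lt.2 hcm)]
        exact hrun c h'
      · have hcp : (c i - (t₀ i + ((2 ^ j : ℕ) : ZMod N))).val < N / 2 := by
          have := cellReflect_mem_halfPlus hN (axisRun_subset_halfMinus hj' t₀ i h')
          rw [cellReflect_cellReflect] at this
          exact mem_halfPlus.1 this
        rw [hMd, if_pos hcp, hrun _ h', hq]
  -- completing the axis
  obtain ⟨v, hv, hrun⟩ := key _ le_rfl
  refine ⟨P i (t₀ i) v, hP i (t₀ i) v hv, fun c hc => ?_⟩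
  rw [mem_boxRun] at hc
  by_cases hci : (c i - t₀ i).val < N / 2
  · rw [hPd, if_pos hci]
    refine hrun c (mem_axisRun.2 ⟨fun i' hi' => hc i' hi', ?_⟩)
    omega
  · have hmem : cellReflect i (t₀ i) c ∈ axisRun t₀ i (Nat.log 2 N) := by
      rw [mem_axisRun]
      refine ⟨fun i' hi' => ?_, ?_⟩
      · rw [cellReflect_apply_of_ne _ _ _ (fun h => by rw [h] at hi'; exact lt_irrefl _ hi')]
        exact hc i' hi'
      · rw [cellReflect_apply_same_sub, zmod_val_neg_sub_one]
        have := ZMod.val_lt (c i - t₀ i)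
        obtain ⟨m, hm⟩ := hN
        omega
    rw [hPd, if_neg hci, hrun _ hmem, hq]

include hPd hMd in
/-- **The doubling argument** (combinatorial core of the extremal proof of the chessboard estimate,
every even `N`): a property of words stable under all symmetrisations passes from `v₀` to any
pattern word `q` through one of its letters (`q t₀ = v₀ t₀`).
[cite: FrohlichIsraelLiebSimon1978, Thm. 4.1 (proof)] -/
theorem reach [NeZero N] (hN : Even N) {Good : (BlockIdx d N → β) → Prop}
    (hP : ∀ i k v, Good v → Good (P i k v)) (hM : ∀ i k v, Good v → Good (M i k v))
    {q : BlockIdx d N → β} (hq : ∀ i k c, ρ i (q (cellReflect i k c)) = q c)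
    {v₀ : BlockIdx d N → β} (h₀ : Good v₀) {t₀ : BlockIdx d N} (ht₀ : v₀ t₀ = q t₀) : Good q := by
  have grow : ∀ m, m ≤ d → ∃ v, Good v ∧ ∀ c ∈ boxRun t₀ m, v c = q c := by
    intro m
    induction m with
    | zero =>
      refine fun _ => ⟨v₀, h₀, fun c hc => ?_⟩
      rw [boxRun_zero, mem_singleton] at hc
      rw [hc, ht₀]
    | succ m ih => exact fun hm => reach_axis hPd hMd hN hP hM hq t₀ ⟨m, hm⟩ (ih (by omega))
  obtain ⟨v, hv, hall⟩ := grow d le_rfl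
  have hvq : v = q := funext fun c => hall c (by rw [boxRun_eq_univ]; exact mem_univ c)
  exact hvq ▸ hv

/-! ### The extremal argument -/

include hPd hMd in
/-- **Zero case.** Under reflection Cauchy–Schwarz at all boundaries, `Φ v ≠ 0` is stable under
symmetrisations, so a word with a letter whose pattern word has `Φ = 0` has `Φ = 0`.
[cite: FrohlichIsraelLiebSimon1978, Thm. 4.1 (proof)] -/
theorem phi_eq_zero_of_pat [NeZero N] (hN : Even N) (Φ : (BlockIdx d N → β) → ℝ)
    (hcyc : ∀ (w : BlockIdx d N → β) (t : BlockIdx d N), Φ (fun c => w (c + t)) = Φ w)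
    (hcs : ∀ i k v, Φ v ^ 2 ≤ Φ (P i k v) * Φ (M i k v))
    {q : BlockIdx d N → β} (hq : ∀ i k c, ρ i (q (cellReflect i k c)) = q c) (hq0 : Φ q = 0)
    {w : BlockIdx d N → β} {t₀ : BlockIdx d N} (hw : w t₀ = q 0) : Φ w = 0 := by
  by_contra hne
  have key : ∀ v, Φ v ≠ 0 → ∀ i k, Φ (P i k v) ≠ 0 ∧ Φ (M i k v) ≠ 0 := by
    intro v hv i k
    have h := hcs i k v
    have hv2 : 0 < Φ v ^ 2 := by positivity
    refine ⟨fun h0 => ?_, fun h0 => ?_⟩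
    · rw [h0, zero_mul] at h; linarith
    · rw [h0, mul_zero] at h; linarith
  have h := reach hPd hMd hN (Good := fun v => Φ v ≠ 0) (fun i k v hv => (key v hv i k).1)
    (fun i k v hv => (key v hv i k).2) hq (v₀ := fun c => w (c + t₀)) (t₀ := 0)
    (by rw [hcyc]; exact hne) (by simpa using hw)
  exact h hq0

include hPd hMd in
/-- The weights of the two symmetrised words multiply to the square of the weight of the word, for a
`ρ`-invariant letter weight `ν`. [cite: FrohlichIsraelLiebSimon1978, Thm. 4.1 (proof)] -/
theorem prod_symP_mul_prod_symM [NeZero N]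
    (ν : β → ℝ) (hν : ∀ i b, ν (ρ i b) = ν b) (i : Fin d) (k : ZMod N) (v : BlockIdx d N → β) :
    (∏ c, ν (P i k v c)) * ∏ c, ν (M i k v c) = (∏ c, ν (v c)) ^ 2 := by
  rw [← prod_mul_distrib]
  have h : ∀ c, ν (P i k v c) * ν (M i k v c) = ν (v c) * ν (v (cellReflect i k c)) := by
    intro c
    rw [hPd, hMd]
    split_ifs <;> simp only [hν, mul_comm]
  simp_rw [h]
  rw [prod_mul_distrib, sq]
  congr 1
  exact Fintype.prod_equiv (cellReflect i k) _ _ (fun c => rfl)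

/-- If `0 < G`, `a, b ≤ G`, `0 ≤ a, b` and `G ^ 2 ≤ a * b`, then `a = G` and `b = G`. [folklore] -/
theorem eq_and_eq_of_sq_le_mul {G a b : ℝ} (hG : 0 < G) (ha : a ≤ G) (hb : b ≤ G) (ha0 : 0 ≤ a)
    (hb0 : 0 ≤ b) (h : G ^ 2 ≤ a * b) : a = G ∧ b = G := by
  constructor
  · refine le_antisymm ha (not_lt.1 fun hlt => ?_)
    nlinarith [mul_le_mul_of_nonneg_left hb ha0, mul_lt_mul_of_pos_right hlt hG]
  · refine le_antisymm hb (not_lt.1 fun hlt => ?_)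
    nlinarith [mul_le_mul_of_nonneg_right ha hb0, mul_lt_mul_of_pos_left hlt hG]

include hPd in
/-- A pattern word is its own `P`-symmetrisation, hence has `Φ ≥ 0` under reflection non-negativity.
[cite: FrohlichIsraelLiebSimon1978, Thm. 4.1] -/
theorem phi_nonneg_of_pattern
    (Φ : (BlockIdx d N → β) → ℝ) (hpos : ∀ i k v, 0 ≤ Φ (P i k v)) {q : BlockIdx d N → β}
    (hq : ∀ i k c, ρ i (q (cellReflect i k c)) = q c) (i : Fin d) : 0 ≤ Φ q := by
  have : P i 0 q = q := funext fun c => by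
    rw [hPd]
    exact ite_eq_iff'.2 ⟨fun _ => rfl, fun _ => hq i 0 c⟩
  rw [← this]
  exact hpos i 0 q

include hPd hMd in
/-- **Positive case (the extremal argument).** If every letter of `w` has a pattern word of positive
`Φ`, then `|Φ w|^(N^d) ≤ ∏_c Φ(pat (w c))`: maximise the ratio over such words; both symmetrisations
of a maximiser are maximisers (Cauchy–Schwarz and `prod_symP_mul_prod_symM`), so by `reach` a
pattern word is a maximiser, where the ratio is `1`.
[cite: FrohlichIsraelLiebSimon1978, Thm. 4.1 (proof)] -/
theorem abs_pow_le_prod_of_pos [NeZero N] [Fintype β] (hN : Even N)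
    (Φ : (BlockIdx d N → β) → ℝ) (hpos : ∀ i k v, 0 ≤ Φ (P i k v))
    (hposM : ∀ i k v, 0 ≤ Φ (M i k v))
    (hcs : ∀ i k v, Φ v ^ 2 ≤ Φ (P i k v) * Φ (M i k v))
    (pat : β → BlockIdx d N → β) (hpat0 : ∀ b, pat b 0 = b)
    (hpatR : ∀ b i k c, ρ i (pat b (cellReflect i k c)) = pat b c)
    (hpatI : ∀ b c, Φ (pat (pat b c)) = Φ (pat b)) (hpatρ : ∀ i b, Φ (pat (ρ i b)) = Φ (pat b))
    (hpat_nonneg : ∀ b, 0 ≤ Φ (pat b)) (w : BlockIdx d N → β) (hw : ∀ c, 0 < Φ (pat (w c))) :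
    |Φ w| ^ (N ^ d) ≤ ∏ c, Φ (pat (w c)) := by
  classical
  have hcard : Fintype.card (BlockIdx d N) = N ^ d := by
    rw [Fintype.card_pi, prod_const, ZMod.card, card_univ, Fintype.card_fin]
  -- the positive-weight words `W` and the ratio `g`
  obtain ⟨W, hW⟩ : ∃ W : Finset (BlockIdx d N → β), ∀ v, v ∈ W ↔ ∀ c, 0 < Φ (pat (v c)) :=
    ⟨univ.filter fun v => ∀ c, 0 < Φ (pat (v c)), fun v => by simp⟩
  obtain ⟨g, hg⟩ : ∃ g : (BlockIdx d N → β) → ℝ, ∀ v, g v = |Φ v| ^ (N ^ d) / ∏ c, Φ (pat (v c)) :=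
    ⟨_, fun _ => rfl⟩
  have hDpos : ∀ {v}, v ∈ W → 0 < ∏ c, Φ (pat (v c)) := fun hv =>
    prod_pos fun c _ => (hW _).1 hv c
  have hg0 : ∀ v, 0 ≤ g v := fun v => by
    rw [hg]; exact div_nonneg (pow_nonneg (abs_nonneg _) _) (prod_nonneg fun c _ => hpat_nonneg _)
  have hgpat : ∀ b, 0 < Φ (pat b) → g (pat b) = 1 := by
    intro b hb
    rw [hg]
    simp only [hpatI, prod_const, card_univ, hcard, abs_of_nonneg hb.le]
    exact div_self (pow_ne_zero _ hb.ne')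
  have hpatW : ∀ b, 0 < Φ (pat b) → pat b ∈ W := fun b hb =>
    (hW _).2 fun c => by rw [hpatI]; exact hb
  have hWP : ∀ i k v, v ∈ W → P i k v ∈ W := by
    intro i k v hv
    rw [hW] at hv ⊢
    intro c
    rw [hPd]
    split_ifs
    · exact hv c
    · rw [hpatρ]; exact hv _
  have hWM : ∀ i k v, v ∈ W → M i k v ∈ W := by
    intro i k v hv
    rw [hW] at hv ⊢
    intro c
    rw [hMd]
    split_ifs
    · rw [hpatρ]; exact hv _
    · exact hv c
  -- Cauchy–Schwarz for the ratio
  have hgcs : ∀ i k v, g v ^ 2 ≤ g (P i k v) * g (M i k v) := by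
    intro i k v
    rw [hg, hg, hg, div_pow, div_mul_div_comm,
      prod_symP_mul_prod_symM hPd hMd (fun b => Φ (pat b)) hpatρ i k v]
    refine div_le_div_of_nonneg_right ?_ (by positivity)
    rw [← pow_mul, mul_comm (N ^ d) 2, pow_mul, ← mul_pow]
    refine pow_le_pow_left₀ (sq_nonneg _) ?_ _
    rw [sq_abs, abs_of_nonneg (hpos i k v), abs_of_nonneg (hposM i k v)]
    exact hcs i k v
  -- a maximiser `vm`; both symmetrisations of a maximiser are maximisers
  have hwW : w ∈ W := (hW _).2 hw
  obtain ⟨vm, hvmW, hmax⟩ := exists_max_image W g ⟨w, hwW⟩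
  have hb0 : 0 < Φ (pat (vm 0)) := (hW _).1 hvmW 0
  have hG1 : 1 ≤ g vm := by rw [← hgpat _ hb0]; exact hmax _ (hpatW _ hb0)
  have hmaxPM : ∀ i k v, v ∈ W → g v = g vm → g (P i k v) = g vm ∧ g (M i k v) = g vm :=
    fun i k v hv hgv => eq_and_eq_of_sq_le_mul (one_pos.trans_le hG1) (hmax _ (hWP i k v hv))
      (hmax _ (hWM i k v hv)) (hg0 _) (hg0 _) (hgv ▸ hgcs i k v)
  -- the pattern word of the letter `vm 0` is a maximiser, and there the ratio is `1`
  have hreach := reach hPd hMd hN (Good := fun v => v ∈ W ∧ g v = g vm)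
    (fun i k v hv => ⟨hWP i k v hv.1, (hmaxPM i k v hv.1 hv.2).1⟩)
    (fun i k v hv => ⟨hWM i k v hv.1, (hmaxPM i k v hv.1 hv.2).2⟩)
    (hpatR (vm 0)) (v₀ := vm) ⟨hvmW, rfl⟩ (t₀ := 0) (by rw [hpat0])
  have hG : g vm = 1 := by rw [← hreach.2, hgpat _ hb0]
  have hgw : g w ≤ 1 := hG ▸ hmax w hwW
  rw [hg] at hgw
  exact (div_le_one (hDpos hwW)).1 hgw

end Generic

end Chessboard

open Chessboard in
/-- **Stub `chessboardAux`: the abstract chessboard estimate in letter form, every even `N`,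
dimension `d`** (Fröhlich–Israel–Lieb–Simon 1978, Thms. 4.1/4.3).  Cells `(ℤ/N)^d`, letters `β`
with maps `ρ i`, any symmetrisation operators `P`, `M` given pointwise by the reflection
`c ↦ c[i ↦ 2k-1-cᵢ]` and the half `{(cᵢ - k).val < N/2}`, a real functional `Φ` on words that is
translation invariant, non-negative on the `P i 0`-symmetrised words and reflection Cauchy–Schwarz
at the boundary `0 | N/2` of every axis, and pattern words `pat b` (`pat b 0 = b`, reflection
symmetric, `Φ ∘ pat` invariant under the letters of `pat b` and under the `ρ i`).  Then every
pattern word has `Φ ≥ 0` and `|Φ w|^(N^d) ≤ ∏_c Φ (pat (w c))`.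
[cite: FrohlichIsraelLiebSimon1978, Thm. 4.3] -/
theorem stub_chessboardAux {d N : ℕ} [NeZero N] (hN : Even N) {β : Type*} [Fintype β]
    (ρ : Fin d → β → β) (P M : Fin d → ZMod N → ((Fin d → ZMod N) → β) → (Fin d → ZMod N) → β)
    (hPd : ∀ i k v c, P i k v c =
      if (c i - k).val < N / 2 then v c else ρ i (v (Function.update c i (2 * k - 1 - c i))))
    (hMd : ∀ i k v c, M i k v c =
      if (c i - k).val < N / 2 then ρ i (v (Function.update c i (2 * k - 1 - c i))) else v c)
    (Φ : ((Fin d → ZMod N) → β) → ℝ)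
    (hcyc : ∀ (w : (Fin d → ZMod N) → β) (t : Fin d → ZMod N), Φ (fun c => w (c + t)) = Φ w)
    (hpos0 : ∀ i v, 0 ≤ Φ (P i 0 v)) (hcs0 : ∀ i v, Φ v ^ 2 ≤ Φ (P i 0 v) * Φ (M i 0 v))
    (pat : β → (Fin d → ZMod N) → β) (hpat0 : ∀ b, pat b 0 = b)
    (hpatR : ∀ b i k c, ρ i (pat b (Function.update c i (2 * k - 1 - c i))) = pat b c)
    (hpatI : ∀ b c, Φ (pat (pat b c)) = Φ (pat b)) (hpatρ : ∀ i b, Φ (pat (ρ i b)) = Φ (pat b))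
    (i₀ : Fin d) (w : (Fin d → ZMod N) → β) :
    (∀ b, 0 ≤ Φ (pat b)) ∧ |Φ w| ^ (N ^ d) ≤ ∏ c, Φ (pat (w c)) := by
  -- the defining formulas and the reflection symmetry in terms of `cellReflect` (definitional)
  have hPd' : ∀ i k v c,
      P i k v c = if (c i - k).val < N / 2 then v c else ρ i (v (cellReflect i k c)) := hPd
  have hMd' : ∀ i k v c,
      M i k v c = if (c i - k).val < N / 2 then ρ i (v (cellReflect i k c)) else v c := hMd
  have hpatR' : ∀ b i k c, ρ i (pat b (cellReflect i k c)) = pat b c := hpatR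
  -- the hypotheses at all boundaries
  have hpos : ∀ i k v, 0 ≤ Φ (P i k v) := fun i k v => by
    rw [symP_eq_shift hPd' i k v, hcyc]; exact hpos0 i _
  have hposM : ∀ i k v, 0 ≤ Φ (M i k v) := fun i k v => by
    rw [symM_eq_symP hPd' hMd' hN]; exact hpos i _ v
  have hcs : ∀ i k v, Φ v ^ 2 ≤ Φ (P i k v) * Φ (M i k v) := fun i k v => by
    rw [symP_eq_shift hPd' i k v, symM_eq_shift hMd' i k v, hcyc, hcyc, ← hcyc v (Pi.single i k)]
    exact hcs0 i _
  have hpat_nonneg : ∀ b, 0 ≤ Φ (pat b) := fun b =>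
    phi_nonneg_of_pattern hPd' Φ hpos (hpatR' b) i₀
  refine ⟨hpat_nonneg, ?_⟩
  by_cases hw : ∀ c, 0 < Φ (pat (w c))
  · exact abs_pow_le_prod_of_pos hPd' hMd' hN Φ hpos hposM hcs pat hpat0 hpatR' hpatI hpatρ
      hpat_nonneg w hw
  · obtain ⟨t₀, ht₀⟩ := not_forall.1 hw
    have h0 : Φ (pat (w t₀)) = 0 := le_antisymm (not_lt.1 ht₀) (hpat_nonneg _)
    have hw0 : Φ w = 0 :=
      phi_eq_zero_of_pat hPd' hMd' hN Φ hcyc hcs (hpatR' (w t₀)) h0 (t₀ := t₀) (by rw [hpat0])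
    rw [hw0, abs_zero, zero_pow (pow_ne_zero _ (NeZero.ne N))]
    exact prod_nonneg fun c _ => hpat_nonneg _

end Summit.QuantumFields.QCD.Theorems.UnquenchedChessboardBoundLine

end
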